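import Literature.NumberTheory.ModularSymbols.CuspidalHomologyFixedLatticeFibre
import Literature.Algebra.Module.IndependentModPrime
import HarnessLib

/-!
# `H(N; ℤ/n) ≅ J₀(N)[n]`: the torsion comparison (the Galois-side half of the LINE 28 dictionary)

Fourth sequel of `CuspidalHomologyShiftNorm` for bsd-stepL LINE 28 (bsd-idea-3 post38 ask (b): "the
`J₀(N)[3] ↔ V₁(𝔽₃)`-fibre dictionary"). The tree's `ModularJacobianGaloisData` puts the Galois action on the
torsion of the complex torus `J0 N = S₂(Γ₀(N))^∨/Λ` (`J0.tors`, `galAct`, `galAct_shiftTors`); the Hecke/lattice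
side of LINE 28 lives on the modular-symbol modules `H(N; R) = R ⊗ Λ` (`CuspidalHomologyHeckeModule`), its
`t`-fixed part `fixedPart`, the sublattice fibre `B_R = fixedLatticeFibre` and `V₁(R)` (`homologyToFibre`,
`CuspidalHomologyFixedLatticeFibre` §4). This file is the bridge: the comparison map
`τ_n : H(N; ℤ/n) → J₀(N)(ℂ)`, `k̄ ⊗ y ↦ k·[n⁻¹y]`, is injective with image the `n`-torsion `J₀(N)[n] = n⁻¹Λ/Λ`
(Darmon–Diamond–Taylor §1.3 p. 27, §4.5 p. 134 «`T_ℓ J₀(N)/ℓ ≅ J₀(N)[ℓ]`»), it is `𝕋_ℤ`-linear and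
`t`-equivariant, and it matches the sub-objects: `τ_n(B_{ℤ/n}) = B ∩ J₀(N)[n]` with `B = Nm J₀(N) = normRange`
(p661679), `τ_n⁻¹(J₀(N)[n]^t) = fixedPart`, and generalised `T_p`-eigenvectors correspond. Everything is proved;
no named facts, no instances, no notation, no Galois action.

* §1 `divMapHecke n : Λ →+ J₀(N)(ℂ)`, `y ↦ [n⁻¹y]` (the tree's `J0.divMap` on the `𝕋_ℤ`-avatar `Λ = periodHomologyHecke`):
  kernel `nΛ`, image `J₀(N)[n]`, `𝕋_ℤ`-linear, `t`-equivariant; `[n⁻¹b] ∈ B` for `b ∈ Λ_B = Λ^t`.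
* §2 `torsionComparison n : H(N; ℤ/n) →+ J₀(N)(ℂ)` (through `ℤ/n ⊗ Λ → Λ/nΛ`, the tree's
  `Literature.Algebra.Module.toQuot`): `τ(k̄ ⊗ y) = k·[n⁻¹y]`; every element of `H(N; ℤ/n)` is `1 ⊗ y`;
  `n·τ = 0`; injective and onto `J₀(N)[n]` for `n ≠ 0`; `τ ∘ T = T ∘ τ` (`T ∈ 𝕋_ℤ`), `τ ∘ t = t_* ∘ τ`.
* §3 the dictionary of sub-objects (`n ≠ 0`): `τ(B_{ℤ/n}) ⊆ B` and `B ∩ J₀(N)[n] ⊆ τ(B_{ℤ/n})`;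
  `x ∈ fixedPart ↔ t_* τ(x) = τ(x)`; `x ∈ ⋃_m ker(T_p − k̄)^m ↔ (T_p − k)^m · τ(x) = 0` for some `m`.
  So the two inputs of `genIsotypicOne_le_range_of_fixedPart_of_fixedLatticeFibre` (p670103) read, on
  `J₀(N)[3]`: "a `t_*`-fixed `3`-torsion point killed by powers of the `T_p − ã_p` lies in `B`" and
  "a `3`-torsion point of `B` killed by powers of the `T_p − χ₋₃(p)ã_p` is `0`".

## References

* H. Darmon, F. Diamond, R. Taylor, *Fermat's Last Theorem*, 1995, §1.3 (p. 27: `Λ` a lattice in `V`,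
  `J = V/Λ`), §4.5 (p. 134: `T_ℓ J₀(N)/ℓ ≅ J₀(N)[ℓ]`).
* U. Stammbach, *Homology in Group Theory*, LNM 359, 1973, II.3 (3.11) (`ℤ/n ⊗ M = M/nM`).
* M. Harrison, the `X₀(108)` shift computations, 2011, §2 (the shift `t`, `B = Nm J`).
-/

noncomputable section

namespace Literature.NumberTheory.ModularSymbols

open Literature.NumberTheory.EllipticCurves Literature.NumberTheory.EllipticCurves.ModularForms CongruenceSubgroup
open scoped TensorProduct

/-! ### §1 `δ_n : Λ → J₀(N)(ℂ)`, `y ↦ [n⁻¹ y]`, on the `𝕋_ℤ`-avatar of `Λ` -/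

section DivMap

variable (N : ℕ) [NeZero N]

/-- **`δ_n : Λ → J₀(N)(ℂ) = S₂^∨/Λ`, `y ↦ [n⁻¹y]`** on `Λ = periodHomologyHecke N` (the same map as the tree's
`J0.divMap` on the additive avatar `periodHomology N`; «`J₀(N)[n] = n⁻¹Λ/Λ`»).
[cite: DarmonDiamondTaylor1995, §1.3 (p. 27)] -/
def divMapHecke (n : ℕ) : periodHomologyHecke N →+ J0 N where
  toFun y := Submodule.Quotient.mk ((n : ℂ)⁻¹ • (y : Module.Dual ℂ (CuspForm (Gamma0 N) 2)))
  map_zero' := by simp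
  map_add' y y' := by
    simp only [Submodule.coe_add, smul_add, Submodule.Quotient.mk_add]

/-- Unfolding `δ_n`. [cite: DarmonDiamondTaylor1995, §1.3 (p. 27)] -/
theorem divMapHecke_apply (n : ℕ) (y : periodHomologyHecke N) :
    divMapHecke N n y = Submodule.Quotient.mk ((n : ℂ)⁻¹ • (y : Module.Dual ℂ (CuspForm (Gamma0 N) 2))) :=
  rfl

/-- `δ_n` IS the tree's `J0.divMap` (on the additive avatar of `Λ`). [cite: DarmonDiamondTaylor1995, §1.3 (p. 27)] -/
theorem divMapHecke_eq_divMap (n : ℕ) (y : periodHomologyHecke N) :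
    divMapHecke N n y = J0.divMap N n ⟨(y : Module.Dual ℂ (CuspForm (Gamma0 N) 2)), y.2⟩ :=
  rfl

/-- `n · [n⁻¹y] = [y] = 0`: `δ_n` lands in `J₀(N)[n]`. [cite: DarmonDiamondTaylor1995, §1.3 (p. 27)] -/
theorem nsmul_divMapHecke (n : ℕ) (y : periodHomologyHecke N) : n • divMapHecke N n y = 0 := by
  rcases eq_or_ne n 0 with rfl | hn
  · simp
  have hn' : (n : ℂ) ≠ 0 := Nat.cast_ne_zero.mpr hn
  rw [divMapHecke_apply, ← Submodule.mkQ_apply, ← map_nsmul, Submodule.mkQ_apply, Submodule.Quotient.mk_eq_zero,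
    ← Nat.cast_smul_eq_nsmul ℂ, smul_smul, mul_inv_cancel₀ hn', one_smul]
  exact y.2

/-- `δ_n (k • y) = k • δ_n y` (`k ∈ ℤ`). [cite: DarmonDiamondTaylor1995, §1.3 (p. 27)] -/
theorem divMapHecke_zsmul (n : ℕ) (k : ℤ) (y : periodHomologyHecke N) :
    divMapHecke N n (k • y) = k • divMapHecke N n y :=
  map_zsmul _ _ _

/-- **Kernel of `δ_n`: `[n⁻¹y] = 0 ↔ y ∈ nΛ`** (`n ≠ 0`). [cite: DarmonDiamondTaylor1995, §1.3 (p. 27)] -/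
theorem divMapHecke_eq_zero_iff {n : ℕ} (hn : n ≠ 0) (y : periodHomologyHecke N) :
    divMapHecke N n y = 0 ↔ ∃ z : periodHomologyHecke N, (n : ℤ) • z = y := by
  have hn' : (n : ℂ) ≠ 0 := Nat.cast_ne_zero.mpr hn
  rw [divMapHecke_apply, Submodule.Quotient.mk_eq_zero]
  constructor
  · intro h
    refine ⟨⟨_, h⟩, Subtype.ext ?_⟩
    rw [Submodule.coe_smul_of_tower, ← Int.cast_smul_eq_zsmul ℂ, Int.cast_natCast, smul_smul,
      mul_inv_cancel₀ hn', one_smul]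
  · rintro ⟨z, rfl⟩
    rw [Submodule.coe_smul_of_tower, ← Int.cast_smul_eq_zsmul ℂ, Int.cast_natCast, smul_smul,
      inv_mul_cancel₀ hn', one_smul]
    exact z.2

/-- **Image of `δ_n`: every `n`-torsion point of `J₀(N)(ℂ)` is `[n⁻¹y]`, `y ∈ Λ`** (`n ≠ 0`).
[cite: DarmonDiamondTaylor1995, §1.3 (p. 27) and §4.5 (p. 134)] -/
theorem exists_divMapHecke_eq {n : ℕ} (hn : n ≠ 0) {z : J0 N} (hz : n • z = 0) :
    ∃ y : periodHomologyHecke N, divMapHecke N n y = z := by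
  obtain ⟨v, rfl⟩ := Submodule.Quotient.mk_surjective (periodHomologyHecke N) z
  rw [← Submodule.mkQ_apply, ← map_nsmul, Submodule.mkQ_apply, Submodule.Quotient.mk_eq_zero] at hz
  have hn' : (n : ℂ) ≠ 0 := Nat.cast_ne_zero.mpr hn
  refine ⟨⟨n • v, hz⟩, ?_⟩
  rw [divMapHecke_apply, Submodule.coe_mk, ← Nat.cast_smul_eq_nsmul ℂ, smul_smul, inv_mul_cancel₀ hn', one_smul]

/-- **`δ_n` is `𝕋_ℤ`-linear**: `[n⁻¹(T y)] = T [n⁻¹y]`. [cite: DarmonDiamondTaylor1995, §1.3 (p. 32)] -/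
theorem divMapHecke_smul (n : ℕ) (T : HeckeRing0 N 2) (y : periodHomologyHecke N) :
    divMapHecke N n (T • y) = T • divMapHecke N n y := by
  rw [divMapHecke_apply, divMapHecke_apply, ← Submodule.Quotient.mk_smul, Submodule.coe_smul]
  rfl

variable (h9 : 3 ^ 2 ∣ N)

/-- **`δ_n` is `t`-equivariant**: `t_* [n⁻¹y] = [n⁻¹(t y)]`. [cite: Harrison2011X0108, §2 (derived reading: t_* is linear on S₂^∨)] -/
theorem shift_divMapHecke (n : ℕ) (y : periodHomologyHecke N) :
    J0.shift N h9 (divMapHecke N n y) = divMapHecke N n (shiftInt N h9 y) := by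
  rw [divMapHecke_apply, divMapHecke_apply, J0.shift_mk, coe_shiftInt, map_smul]

/-- **`[n⁻¹b] ∈ B = Nm J₀(N)` for `b ∈ Λ_B = Λ^t`**: `[n⁻¹b] = Nm[(3n)⁻¹b]` since `Nm b = 3b`.
[cite: Harrison2011X0108, §2 (derived reading: Nm = 3 on the t-fixed part)] -/
theorem divMapHecke_mem_normRange (n : ℕ) {b : periodHomologyHecke N} (hb : b ∈ fixedLattice N h9) :
    divMapHecke N n b ∈ normRange N h9 := by
  have ht : shiftDual N h9 (b : Module.Dual ℂ (CuspForm (Gamma0 N) 2)) = b := by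
    rw [← coe_shiftInt, (mem_fixedLattice_iff N h9 b).mp hb]
  refine ⟨Submodule.Quotient.mk (((3 : ℂ) * n)⁻¹ • (b : Module.Dual ℂ (CuspForm (Gamma0 N) 2))), ?_⟩
  rw [jacobianNorm_mk, map_smul, normDual_apply, ht, ht, divMapHecke_apply]
  congr 1
  rw [show (b : Module.Dual ℂ (CuspForm (Gamma0 N) 2)) + b + b = (3 : ℂ) • (b : Module.Dual ℂ (CuspForm (Gamma0 N) 2)) by
      rw [show (3 : ℂ) = 1 + 1 + 1 by norm_num, add_smul, add_smul, one_smul],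
    smul_smul, mul_inv_rev, mul_assoc, inv_mul_cancel₀ (by norm_num : (3 : ℂ) ≠ 0), mul_one]

/-- **Conversely, `B ∩ J₀(N)[n] ⊆ δ_n(Λ_B)`**: an `n`-torsion point of `B = Nm J₀(N)` is `[n⁻¹b]` with `b ∈ Λ^t`
(`z = [Nm w]`, `b := n·Nm w ∈ Λ`, `t b = b`). [cite: Harrison2011X0108, §2 (derived reading: t Nm = Nm)] -/
theorem exists_mem_fixedLattice_divMapHecke_eq {n : ℕ} (hn : n ≠ 0) {z : J0 N} (hz : z ∈ normRange N h9)
    (hnz : n • z = 0) : ∃ b ∈ fixedLattice N h9, divMapHecke N n b = z := by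
  obtain ⟨w, rfl⟩ := hz
  obtain ⟨φ, rfl⟩ := Submodule.Quotient.mk_surjective (periodHomologyHecke N) w
  rw [jacobianNorm_mk] at hnz ⊢
  rw [← Submodule.mkQ_apply, ← map_nsmul, Submodule.mkQ_apply, Submodule.Quotient.mk_eq_zero] at hnz
  have hn' : (n : ℂ) ≠ 0 := Nat.cast_ne_zero.mpr hn
  refine ⟨⟨n • normDual N h9 φ, hnz⟩, ?_, ?_⟩
  · rw [mem_fixedLattice_iff]
    apply Subtype.ext
    rw [coe_shiftInt, Submodule.coe_mk, ← Nat.cast_smul_eq_nsmul ℂ, map_smul, ← Module.End.mul_apply,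
      shiftDual_mul_normDual]
  · rw [divMapHecke_apply, Submodule.coe_mk, ← Nat.cast_smul_eq_nsmul ℂ, smul_smul, inv_mul_cancel₀ hn', one_smul]

end DivMap

/-! ### §2 `τ_n : H(N; ℤ/n) → J₀(N)(ℂ)`, `k̄ ⊗ y ↦ k·[n⁻¹y]`: injective with image `J₀(N)[n]` -/

section Comparison

variable (N : ℕ) [NeZero N]

/-- `nΛ ⊆ ker δ_n`. [cite: DarmonDiamondTaylor1995, §1.3 (p. 27)] -/
theorem modMultiples_le_ker_divMapHecke (n : ℕ) :
    Literature.Algebra.Module.modMultiples n (periodHomologyHecke N) ≤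
      LinearMap.ker (divMapHecke N n).toIntLinearMap := by
  intro y hy
  obtain ⟨z, rfl⟩ := (Literature.Algebra.Module.mem_modMultiples_iff n y).mp hy
  rw [LinearMap.mem_ker, AddMonoidHom.coe_toIntLinearMap, divMapHecke_zsmul, natCast_zsmul, nsmul_divMapHecke]

/-- **The torsion comparison `τ_n : H(N; ℤ/n) = ℤ/n ⊗ Λ → J₀(N)(ℂ)`, `k̄ ⊗ y ↦ k·[n⁻¹y]`** — the composite
`ℤ/n ⊗ Λ → Λ/nΛ → J₀(N)(ℂ)` of the tree's `Literature.Algebra.Module.toQuot` with `δ_n` (which kills `nΛ`).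
«`T_ℓ J₀(N)/ℓ T_ℓ J₀(N) ≅ J₀(N)[ℓ]`», i.e. `Λ/ℓΛ ≅ J₀(N)[ℓ]`. [cite: DarmonDiamondTaylor1995, §4.5 (p. 134)] -/
def torsionComparison (n : ℕ) : CuspidalHomologyHeckeModule N (ZMod n) →+ J0 N :=
  ((Literature.Algebra.Module.modMultiples n (periodHomologyHecke N)).liftQ (divMapHecke N n).toIntLinearMap
      (modMultiples_le_ker_divMapHecke N n)).toAddMonoidHom.comp
    (Literature.Algebra.Module.toQuot n (periodHomologyHecke N))

/-- `τ_n (k̄ ⊗ y) = k · [n⁻¹y]`. [cite: DarmonDiamondTaylor1995, §4.5 (p. 134)] -/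
theorem torsionComparison_intCast_tmul (n : ℕ) (k : ℤ) (y : periodHomologyHecke N) :
    torsionComparison N n ((k : ZMod n) ⊗ₜ[ℤ] y) = k • divMapHecke N n y := by
  rw [torsionComparison, AddMonoidHom.comp_apply, Literature.Algebra.Module.toQuot_tmul_intCast,
    LinearMap.toAddMonoidHom_coe, Submodule.mkQ_apply, Submodule.liftQ_apply, AddMonoidHom.coe_toIntLinearMap,
    divMapHecke_zsmul]

/-- `τ_n (1 ⊗ y) = [n⁻¹y]`. [cite: DarmonDiamondTaylor1995, §4.5 (p. 134)] -/
theorem torsionComparison_one_tmul (n : ℕ) (y : periodHomologyHecke N) :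
    torsionComparison N n ((1 : ZMod n) ⊗ₜ[ℤ] y) = divMapHecke N n y := by
  rw [← Int.cast_one, torsionComparison_intCast_tmul, one_smul]

/-- **Every element of `H(N; ℤ/n)` is a class `1 ⊗ y`, `y ∈ Λ`** (`ℤ/n ⊗ Λ = Λ/nΛ`).
[cite: Stammbach1973HomologyGroupTheory, II.3 (3.11)] -/
theorem exists_eq_one_tmul (n : ℕ) (x : CuspidalHomologyHeckeModule N (ZMod n)) :
    ∃ y : periodHomologyHecke N, x = (1 : ZMod n) ⊗ₜ[ℤ] y := by
  induction x using TensorProduct.induction_on with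
  | zero => exact ⟨0, (TensorProduct.tmul_zero _ _).symm⟩
  | tmul r y =>
    obtain ⟨k, rfl⟩ := ZMod.intCast_surjective r
    exact ⟨k • y, Literature.Algebra.Module.intCast_tmul n k y⟩
  | add a b ha hb =>
    obtain ⟨y, rfl⟩ := ha
    obtain ⟨y', rfl⟩ := hb
    exact ⟨y + y', (TensorProduct.tmul_add _ _ _).symm⟩

/-- `n · τ_n = 0`: `τ_n` lands in `J₀(N)[n]`. [cite: DarmonDiamondTaylor1995, §4.5 (p. 134)] -/
theorem nsmul_torsionComparison (n : ℕ) (x : CuspidalHomologyHeckeModule N (ZMod n)) :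
    n • torsionComparison N n x = 0 := by
  obtain ⟨y, rfl⟩ := exists_eq_one_tmul N n x
  rw [torsionComparison_one_tmul, nsmul_divMapHecke]

/-- **`τ_n` is injective** (`n ≠ 0`): `Λ/nΛ ↪ J₀(N)(ℂ)`. [cite: DarmonDiamondTaylor1995, §4.5 (p. 134)] -/
theorem torsionComparison_injective {n : ℕ} (hn : n ≠ 0) : Function.Injective (torsionComparison N n) := by
  refine (injective_iff_map_eq_zero _).mpr fun x hx ↦ ?_
  obtain ⟨y, rfl⟩ := exists_eq_one_tmul N n x
  rw [torsionComparison_one_tmul, divMapHecke_eq_zero_iff N hn] at hx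
  exact (Literature.Algebra.Module.one_tmul_eq_zero_iff_exists_smul n y).mpr hx

/-- `τ_n x = 0 ↔ x = 0` (`n ≠ 0`). [cite: DarmonDiamondTaylor1995, §4.5 (p. 134)] -/
theorem torsionComparison_eq_zero_iff {n : ℕ} (hn : n ≠ 0) (x : CuspidalHomologyHeckeModule N (ZMod n)) :
    torsionComparison N n x = 0 ↔ x = 0 :=
  ⟨fun h ↦ torsionComparison_injective N hn (by rw [h, map_zero]), fun h ↦ by rw [h, map_zero]⟩

/-- **`τ_n` is onto `J₀(N)[n]`** (`n ≠ 0`): every `n`-torsion point of `J₀(N)(ℂ)` is in the image. With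
`nsmul_torsionComparison` and `torsionComparison_injective`: `H(N; ℤ/n) ≅ J₀(N)[n]`.
[cite: DarmonDiamondTaylor1995, §4.5 (p. 134)] -/
theorem exists_torsionComparison_eq {n : ℕ} (hn : n ≠ 0) {z : J0 N} (hz : n • z = 0) :
    ∃ x : CuspidalHomologyHeckeModule N (ZMod n), torsionComparison N n x = z := by
  obtain ⟨y, hy⟩ := exists_divMapHecke_eq N hn hz
  exact ⟨(1 : ZMod n) ⊗ₜ[ℤ] y, by rw [torsionComparison_one_tmul, hy]⟩

/-- **`τ_n` is `𝕋_ℤ`-linear**: `τ_n ∘ (1 ⊗ T) = T ∘ τ_n`. [cite: DarmonDiamondTaylor1995, §1.3 (p. 32) (derived reading, see `divMapHecke_smul`)] -/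
theorem torsionComparison_hecke (n : ℕ) (T : HeckeRing0 N 2) (x : CuspidalHomologyHeckeModule N (ZMod n)) :
    torsionComparison N n (hecke N (ZMod n) T x) = T • torsionComparison N n x := by
  obtain ⟨y, rfl⟩ := exists_eq_one_tmul N n x
  rw [hecke_tmul, torsionComparison_one_tmul, torsionComparison_one_tmul, divMapHecke_smul]

/-- `τ_n (T_p x) = T_p · τ_n x`. [cite: DarmonDiamondTaylor1995, §1.3 (p. 32) (derived reading)] -/
theorem torsionComparison_heckeOp (n : ℕ) (p : ℕ) (hp : p.Prime) (x : CuspidalHomologyHeckeModule N (ZMod n)) :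
    torsionComparison N n (heckeOp N (ZMod n) p hp x) = HeckeRing0.T N 2 p hp • torsionComparison N n x :=
  torsionComparison_hecke N n _ x

/-- `τ_n (k • x) = k • τ_n x` for the `ℤ/n`-scalar `k̄` (`k ∈ ℤ`). [cite: Stammbach1973HomologyGroupTheory, II.3 (3.11) (derived reading)] -/
theorem torsionComparison_intCast_smul (n : ℕ) (k : ℤ) (x : CuspidalHomologyHeckeModule N (ZMod n)) :
    torsionComparison N n ((k : ZMod n) • x) = k • torsionComparison N n x := by
  rw [Int.cast_smul_eq_zsmul, map_zsmul]

variable (h9 : 3 ^ 2 ∣ N)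

/-- **`τ_n` is `t`-equivariant**: `τ_n (t x) = t_* τ_n(x)`. [cite: Harrison2011X0108, §2 (derived reading, see `shift_divMapHecke`)] -/
theorem torsionComparison_shift (n : ℕ) (x : CuspidalHomologyHeckeModule N (ZMod n)) :
    torsionComparison N n (shift N h9 (ZMod n) x) = J0.shift N h9 (torsionComparison N n x) := by
  obtain ⟨y, rfl⟩ := exists_eq_one_tmul N n x
  rw [shift_tmul, torsionComparison_one_tmul, torsionComparison_one_tmul, shift_divMapHecke]

end Comparison

/-! ### §3 The dictionary of sub-objects: `B_{ℤ/n} ↔ B ∩ J₀(N)[n]`, `fixedPart ↔ J₀(N)[n]^t`, eigenvectors -/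

section Dictionary

variable (N : ℕ) [NeZero N] (h9 : 3 ^ 2 ∣ N)

/-- **`τ_n(B_{ℤ/n}) ⊆ B`**: the fibre of the fixed sublattice maps into `B = Nm J₀(N)`.
[cite: Harrison2011X0108, §2 (derived reading, see `divMapHecke_mem_normRange`)] -/
theorem torsionComparison_mem_normRange (n : ℕ) {x : CuspidalHomologyHeckeModule N (ZMod n)}
    (hx : x ∈ fixedLatticeFibre N h9 (ZMod n)) : torsionComparison N n x ∈ normRange N h9 := by
  obtain ⟨w, rfl⟩ := hx
  induction w using TensorProduct.induction_on with
  | zero => rw [map_zero, map_zero]; exact (normRange N h9).zero_mem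
  | tmul r b =>
    obtain ⟨k, rfl⟩ := ZMod.intCast_surjective r
    rw [LinearMap.baseChange_tmul, Submodule.subtype_apply, torsionComparison_intCast_tmul]
    exact (normRange N h9).zsmul_mem (divMapHecke_mem_normRange N h9 n b.2) k
  | add a b ha hb =>
    rw [map_add, map_add]
    exact (normRange N h9).add_mem ha hb

/-- **`B ∩ J₀(N)[n] ⊆ τ_n(B_{ℤ/n})`** (`n ≠ 0`): an `n`-torsion point of `B` comes from the fibre of `Λ_B`.
[cite: Harrison2011X0108, §2 (derived reading, see `exists_mem_fixedLattice_divMapHecke_eq`)] -/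
theorem exists_mem_fixedLatticeFibre_torsionComparison_eq {n : ℕ} (hn : n ≠ 0) {z : J0 N}
    (hz : z ∈ normRange N h9) (hnz : n • z = 0) :
    ∃ x ∈ fixedLatticeFibre N h9 (ZMod n), torsionComparison N n x = z := by
  obtain ⟨b, hb, rfl⟩ := exists_mem_fixedLattice_divMapHecke_eq N h9 hn hz hnz
  exact ⟨(1 : ZMod n) ⊗ₜ[ℤ] b, tmul_mem_fixedLatticeFibre N h9 (ZMod n) 1 hb, torsionComparison_one_tmul N n b⟩

/-- **`x ∈ B_{ℤ/n} ↔ τ_n x ∈ B`** (`n ≠ 0`). [cite: Harrison2011X0108, §2 (derived reading)] -/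
theorem mem_fixedLatticeFibre_iff_torsionComparison_mem_normRange {n : ℕ} (hn : n ≠ 0)
    (x : CuspidalHomologyHeckeModule N (ZMod n)) :
    x ∈ fixedLatticeFibre N h9 (ZMod n) ↔ torsionComparison N n x ∈ normRange N h9 := by
  refine ⟨torsionComparison_mem_normRange N h9 n, fun h ↦ ?_⟩
  obtain ⟨x', hx', he⟩ :=
    exists_mem_fixedLatticeFibre_torsionComparison_eq N h9 hn h (nsmul_torsionComparison N n x)
  rwa [← torsionComparison_injective N hn he]

/-- **`x ∈ fixedPart ↔ t_* τ_n(x) = τ_n(x)`** (`n ≠ 0`): `τ_n⁻¹(J₀(N)[n]^t) = H(N; ℤ/n)^t`.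
[cite: Harrison2011X0108, §2 (derived reading, see `torsionComparison_shift`)] -/
theorem mem_fixedPart_iff_shift_torsionComparison {n : ℕ} (hn : n ≠ 0) (x : CuspidalHomologyHeckeModule N (ZMod n)) :
    x ∈ fixedPart N h9 (ZMod n) ↔ J0.shift N h9 (torsionComparison N n x) = torsionComparison N n x := by
  rw [mem_fixedPart_iff, ← torsionComparison_shift, (torsionComparison_injective N hn).eq_iff]

/-- `τ_n ((T_p − k̄)^m x) = (T_p − k)^m · τ_n x`. [cite: DarmonDiamondTaylor1995, §1.3 (p. 32) (derived reading: bookkeeping over `torsionComparison_hecke`)] -/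
theorem torsionComparison_heckeOp_sub_pow (n : ℕ) (p : ℕ) (hp : p.Prime) (k : ℤ) (m : ℕ)
    (x : CuspidalHomologyHeckeModule N (ZMod n)) :
    torsionComparison N n
        ((((heckeOp N (ZMod n) p hp : Module.End (ZMod n) (CuspidalHomologyHeckeModule N (ZMod n))) -
            (k : ZMod n) • (1 : Module.End (ZMod n) (CuspidalHomologyHeckeModule N (ZMod n)))) ^ m) x) =
      (HeckeRing0.T N 2 p hp - k) ^ m • torsionComparison N n x := by
  induction m generalizing x with
  | zero => rw [pow_zero, pow_zero, Module.End.one_apply, one_smul]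
  | succ m ih =>
    rw [pow_succ, Module.End.mul_apply, ih, LinearMap.sub_apply, LinearMap.smul_apply, Module.End.one_apply,
      map_sub, torsionComparison_heckeOp, torsionComparison_intCast_smul, pow_succ, mul_smul, sub_smul,
      Int.cast_smul_eq_zsmul]

/-- **Generalised eigenvectors correspond**: `x ∈ ⋃_m ker(T_p − k̄)^m` on `H(N; ℤ/n)` iff some power of
`T_p − k ∈ 𝕋_ℤ` kills `τ_n x` in `J₀(N)(ℂ)` (`n ≠ 0`). [cite: DarmonDiamondTaylor1995, §1.3 (p. 32) (derived reading)] -/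
theorem mem_maxGenEigenspace_heckeOp_iff {n : ℕ} (hn : n ≠ 0) (p : ℕ) (hp : p.Prime) (k : ℤ)
    (x : CuspidalHomologyHeckeModule N (ZMod n)) :
    x ∈ Module.End.maxGenEigenspace (heckeOp N (ZMod n) p hp) (k : ZMod n) ↔
      ∃ m : ℕ, (HeckeRing0.T N 2 p hp - k) ^ m • torsionComparison N n x = 0 := by
  rw [Module.End.mem_maxGenEigenspace]
  refine exists_congr fun m ↦ ?_
  rw [← torsionComparison_heckeOp_sub_pow, torsionComparison_eq_zero_iff N hn]

end Dictionary

end Literature.NumberTheory.ModularSymbols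

end
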